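import Literature.AlgebraicGeometry.Motives.AbelianVarietySimpleOfEndAlgebraDomain
import Literature.AlgebraicGeometry.Motives.AbelianVarietyImage
import Literature.AlgebraicGeometry.Motives.AbelianVarietyBlochFiltrationTransfer
import HarnessLib

/-!
# The cofinite annihilator of a proper abelian subvariety (Poincaré complement + quasi-inverse)

Topic `Literature/AlgebraicGeometry/Motives`, namespace `Literature.AlgebraicGeometry.Motives.AbelianVariety`. THEOREMS ONLY (no definition, no
named fact; net Literature debt 0). Cell `pub-hodge-ring2` (research route conditional on HC_CM; not a corollary), crux stmt-HodgeConjecture-26512,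
lens line «mover trap» node S2 (`stub_moverConfinement_of_KSimple`), sub-lemma A1 of core-w5 g3's S2 k0 memo
(`Cruxes/DiagLocalOfMarkmanPinnedForall/Lines/MoverTrap-S2-K0.md` 3e0ae078db5b1bc4, §3; CUT l.5810, piece P1, signature frozen there), seat core-w3 g2.

For a homomorphism `g : C → Y` of complex abelian varieties whose image on `ℂ`-points is NOT all of `Y(ℂ)`:

* `exists_cofinite_annihilator_of_range_ne_univ` — **there are a NON-ZERO homomorphism `π : Y → Z` with `g ≫ π = 0` and `N > 0` such that every
  `ℂ`-point `y` with `π(y) = 1` has `y^N ∈ g(C(ℂ))`** («the annihilator of the abelian subvariety `im g` is cofinite over it»). Proof (Mumford §19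
  Thm. 1 + Remark p. 169): let `i : im g ↪ Y` be the image (`AbelianVariety.imageι`, a closed immersion; `g = toImage g ≫ i` with `toImage g`
  surjective, so `i` and `g` have the same range on `ℂ`-points); Poincaré's complete reducibility (`poincare_complete_reducibility`, a tree THEOREM)
  gives an abelian subvariety `j : Z ↪ Y` with `σ := (i, j) : im g ⊞ Z → Y` an isogeny; a quasi-inverse `σ'` (`σ ≫ σ' = N`, `σ' ≫ σ = N`,
  `IsIsogeny.exists_nsmul_inverse_holds`) gives `π := σ' ≫ pr₂ : Y → Z`. Then `g ≫ π = toImage g ≫ inl ≫ σ ≫ σ' ≫ pr₂ = N · (toImage g ≫ inl ≫ pr₂) = 0`;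
  for `π(y) = 1` one has `y^N = σ(σ'(y)) = i(pr₁ σ'(y)) · j(pr₂ σ'(y)) = i(pr₁ σ'(y)) ∈ range i = range g`; and `π = 0` would put every `N`-th
  power, hence (divisibility of `Y(ℂ)`, `exists_pow_eq`) every point, in `range g` — excluded.
* points bookkeeping restated locally (the Summits-side `pointsMap_comp_apply`/`pointsMap_add` are not importable here): public
  `pointsMap_add_apply`, `pointsMap_zero_apply`, `pointsMap_nsmul_apply` (Mumford §19, `Hom(X, Y)` is a group pointwise); private `pointsMap_comp_apply'`,
  `pointsMap_id_apply`.

## References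
* [MumfordAV1970] D. Mumford, *Abelian Varieties* (1970), §19 Thm. 1 (p. 173: Poincaré's complete reducibility) and Remark p. 169
  (quasi-inverse of an isogeny).
* [Milne1986AbelianVarieties] J. S. Milne, *Abelian Varieties* (1986), §12 Prop. 12.1 and Thm. 8.2 (divisibility).
-/

noncomputable section

universe u

open CategoryTheory CategoryTheory.Limits AlgebraicGeometry

namespace Literature.AlgebraicGeometry.Motives

namespace AbelianVariety

/-! ### Points bookkeeping (local restatements) -/

section Points

variable {K : Type u} [Field K] {P Q R : AbelianVariety K} (L : Type u) [Field L] [Algebra K L]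

/-- `(f ≫ g)(y) = g(f(y))` on `L`-points. [folklore] -/
private theorem pointsMap_comp_apply' (f : P ⟶ Q) (g : Q ⟶ R) (y : P.Points L) :
    pointsMap L (f ≫ g) y = pointsMap L g (pointsMap L f y) := by
  rw [pointsMap_apply, pointsMap_apply, pointsMap_apply, AlgPoints.map_apply, AlgPoints.map_apply, AlgPoints.map_apply]
  exact (Category.assoc _ _ _).symm

/-- `(f + f')(y) = f(y) · f'(y)` on `L`-points (the group law on `Hom` is the pointwise one). [cite: MumfordAV1970, §19 (Hom(X,Y), first paragraph)] -/
theorem pointsMap_add_apply (f f' : P ⟶ Q) (y : P.Points L) :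
    pointsMap L (f + f') y = pointsMap L f y * pointsMap L f' y := by
  rw [pointsMap_apply, pointsMap_apply, pointsMap_apply, AlgPoints.map_apply, AlgPoints.map_apply, AlgPoints.map_apply]
  exact MonObj.comp_mul _ _ _

/-- `0(y) = 1` on `L`-points. [cite: MumfordAV1970, §19 (Hom(X,Y), first paragraph)] -/
theorem pointsMap_zero_apply (y : P.Points L) : pointsMap L (0 : P ⟶ Q) y = 1 := by
  rw [pointsMap_apply, AlgPoints.map_apply]
  exact MonObj.comp_one y

/-- `𝟙(y) = y` on `L`-points. [folklore] -/
private theorem pointsMap_id_apply (y : P.Points L) : pointsMap L (𝟙 P) y = y := by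
  rw [pointsMap_apply, AlgPoints.map_apply]
  exact Category.comp_id _

/-- `(N • f)(y) = f(y)^N` on `L`-points. [cite: MumfordAV1970, §19 (Hom(X,Y), first paragraph)] -/
theorem pointsMap_nsmul_apply (N : ℕ) (f : P ⟶ Q) (y : P.Points L) :
    pointsMap L (N • f) y = pointsMap L f y ^ N := by
  induction N with
  | zero => rw [zero_smul, pow_zero, pointsMap_zero_apply]
  | succ n ih => rw [add_smul, one_smul, pointsMap_add_apply, ih, pow_succ]

end Points

/-! ### The cofinite annihilator -/

/-- **Cofinite annihilator of a proper abelian subvariety.** For a homomorphism `g : C → Y` of complex abelian varieties with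
`g(C(ℂ)) ≠ Y(ℂ)` there are a non-zero homomorphism `π : Y → Z` with `g ≫ π = 0` and `N > 0` such that every `ℂ`-point `y` with `π(y) = 1`
satisfies `y^N ∈ g(C(ℂ))` (Poincaré complement `Z` of `im g`, quasi-inverse `σ'` of `(im g) ⊞ Z → Y`, `π = σ' ≫ pr₂`).
[cite: MumfordAV1970, §19 Thm. 1 (p. 173) and Remark p. 169 (quasi-inverse of an isogeny)] [cite: Milne1986AbelianVarieties, §12 Prop. 12.1] -/
theorem exists_cofinite_annihilator_of_range_ne_univ {C Y : AbelianVariety ℂ} (g : C ⟶ Y)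
    (hg : Set.range (pointsMap ℂ g) ≠ Set.univ) :
    ∃ (Z : AbelianVariety ℂ) (π : Y ⟶ Z) (N : ℕ), π ≠ 0 ∧ g ≫ π = 0 ∧ 0 < N ∧
      ∀ y : Y.Points ℂ, pointsMap ℂ π y = 1 → y ^ N ∈ Set.range (pointsMap ℂ g) := by
  classical
  -- the image `i : im g ↪ Y`, its Poincaré complement `j : Z ↪ Y`, and a quasi-inverse `σ'` of `σ = (i, j)`
  obtain ⟨Z, j, -, hσ⟩ := poincare_complete_reducibility (imageι g)
  obtain ⟨σ', N, hN, hσσ', hσ'σ⟩ := IsIsogeny.exists_nsmul_inverse_holds hσ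
  -- the range of `g` on points is that of `imageι g`
  have hrange : ∀ v, pointsMap ℂ (imageι g) v ∈ Set.range (pointsMap ℂ g) := by
    intro v
    obtain ⟨c, hc⟩ := pointsMap_surjective (toImage g) inferInstance v
    refine ⟨c, ?_⟩
    rw [← hc, ← pointsMap_comp_apply' ℂ, toImage_imageι]
  -- the kernel clause: `π(y) = 1 ⟹ y^N = i(pr₁ σ'(y)) ∈ range g`
  have hker : ∀ y : Y.Points ℂ, pointsMap ℂ (σ' ≫ biprod.snd) y = 1 → y ^ N ∈ Set.range (pointsMap ℂ g) := by
    intro y hy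
    have h1 : y ^ N = pointsMap ℂ (σ' ≫ biprod.desc (imageι g) j) y := by
      rw [hσ'σ, pointsMap_nsmul_apply, pointsMap_id_apply]
    have h2 : pointsMap ℂ (σ' ≫ biprod.desc (imageι g) j) y =
        pointsMap ℂ (imageι g) (pointsMap ℂ (σ' ≫ biprod.fst) y) * pointsMap ℂ j (pointsMap ℂ (σ' ≫ biprod.snd) y) := by
      rw [biprod.desc_eq, Preadditive.comp_add, pointsMap_add_apply, ← Category.assoc σ' biprod.fst (imageι g),
        ← Category.assoc σ' biprod.snd j, pointsMap_comp_apply' ℂ (σ' ≫ biprod.fst), pointsMap_comp_apply' ℂ (σ' ≫ biprod.snd)]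
    rw [h2, hy, map_one, mul_one] at h1
    rw [h1]
    exact hrange _
  refine ⟨Z, σ' ≫ biprod.snd, N, ?_, ?_, hN, hker⟩
  · -- `π ≠ 0`: otherwise every `N`-th power, hence every point, lies in the range of `g`
    intro hπ
    apply hg
    refine Set.eq_univ_of_forall fun x => ?_
    obtain ⟨y, rfl⟩ := exists_pow_eq Y hN.ne' x
    refine hker y ?_
    rw [hπ, pointsMap_zero_apply]
  · -- `g ≫ π = 0`
    have key : imageι g ≫ σ' ≫ biprod.snd = 0 := by
      rw [← biprod.inl_desc (imageι g) j, Category.assoc, reassoc_of% hσσ', Preadditive.nsmul_comp, Category.id_comp,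
        Preadditive.comp_nsmul, biprod.inl_snd, smul_zero]
    have e : g ≫ σ' ≫ biprod.snd = toImage g ≫ (imageι g ≫ σ' ≫ biprod.snd) := by
      rw [← Category.assoc (toImage g), toImage_imageι]
    rw [e, key, Limits.comp_zero]

end AbelianVariety

end Literature.AlgebraicGeometry.Motives

end
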